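import Literature.AnabelianGeometry.EtaleTheta.FrobenioidThetaToyNine

/-!
# [EtTh] §5 at toy no. 9: abc-iut-L2-t4's `Facts` HOLDS with `s^⊔_N ≠ s^⊓_N`; the dictionary rows F-1306
# `CyclotomicCharacterCompatX` and F-0521 `ThetaSectionCompat` HOLD — the latter for a NON-TRIVIAL theta cocycle (pp. 330–332 / PDF pp. 104–106)

Mochizuki, *The étale theta function and its Frobenioid-theoretic manifestations*, Publ. RIMS **45** (2009)
[cite: MochizukiEtTh2009, §5 p.330–332 (PDF pp.104–106); Lem 5.8 proof p.331 (PDF p.105); Prop 5.2 (iii) p.324 (PDF p.98);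
Prop 4.3 (iii) p.317 (PDF p.91)].  abc-iut cell, block F, seat abc-iut-f-116 (gen 3), tranche 116 (F-0521 / F-1306 / F-0520).
PROOF-ONLY companion (0 `def`, 0 instance, 0 `Prop` fact; nothing landed is edited) of this seat's witness-data file
`FrobenioidThetaToyNine.lean` (toy no. 9: `toy₉`, `env₉`, `muEquiv₉`).

WHAT IS PROVED (every statement a kernel computation in `G₉ = ℤ/9 ⋊ (ℤ/3 × ℤˣ)`):
* `homOf_diff_toy₉` — the bi-Kummer difference `s^⊔-gp_N(h)·s^⊓-gp_N(h)⁻¹` of toy no. 9 IS the Kummer cocycle `1 − kumChar(h)`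
  of the unit `w = s^⊔_N`; `biKummerDifferenceMem_toy₉` — it is `μ_3(B_N)`-valued on `H_{B_N}` (Prop. 4.3 (iii));
  `sgpCupSpec_toy₉` — the defining relation of `s^⊔-gp_N` relative to `s^⊔_N = w` (p.331) holds;
* `constantsActByCyclotome_toy₉` — Lemma 5.8's arithmetic step at toy no. 9: a unit of `ℤ/9` is acted on by `Π^tp_Y̲` via
  `μ_3(B_N)` iff it lies in `3ℤ/9 = (O_K^×)^{1/3}` (the element `x₋ ∈ Π^tp_Y̲` acts by `−1`);
* **`facts_toy₉ : toy₉.Facts`** — all eight §5 named inputs of abc-iut-L2-t4 at a closed datum with `s^⊔_N ≠ s^⊓_N`;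
* **`cyclotomicCharacterCompatX_toy₉`** (F-1306, `ι = id`, `m = muEquiv₉`): conjugation by `s^⊓-gp_N(ρ g)` on `μ_3(B_N)` is the
  inversion character `χ(aug g)` for ALL `g ∈ Π^tp_X̲` (`4 ≡ 1 mod 3`);
* **`thetaSectionCompat_toy₉`** (F-0521) for the NON-TRIVIAL theta cocycle `η₉ = b mod 3`: through `m` the difference cocycle
  at `h = (0, b, τ)` is `(1 − 4^b)/3 = −b mod 3 = η₉(h)⁻¹` — "the Kummer class determined by the bi-Kummer `N`-th root …
  corresponds precisely to the reduction modulo `N` of the class `η̲̈^Θ`" (Prop. 5.2 (iii)) REALISED non-trivially on closed data.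
HONEST FRAMING: consistency / non-vacuity computations for OUR typed interfaces; the toy is not the tempered Frobenioid of a
Tate curve and asserts nothing about [EtTh] (a refereed paper) or [IUTchIII] Cor. 3.12; a FACT row is an assumption label;
typed ≠ proved; no side is taken.
-/

namespace Literature.AnabelianGeometry.EtaleTheta

open CategoryTheory
open Literature.AlgebraicGeometry.Frobenioids

namespace ThetaFrobenioid

namespace Toy

/-! ### Computations in `toy₉` -/

/-- Conjugating a unit `inl n` by `g ∈ Aut_C(B_N)` is the action of `g^bs` (plumbing).
[cite: MochizukiEtTh2009, Lem 5.8 p.331 (PDF p.105)] -/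
theorem conj_inl_G₉ (g : G₉) (n : Multiplicative (ZMod 9)) :
    g * SemidirectProduct.inl n * g⁻¹ = SemidirectProduct.inl (kumAction g.right n) := by
  refine SemidirectProduct.ext ?_ ?_
  · simp only [SemidirectProduct.mul_left, SemidirectProduct.mul_right, SemidirectProduct.inv_left,
      SemidirectProduct.left_inl, SemidirectProduct.right_inl, mul_one, ← MulAut.mul_apply, ← map_mul,
      mul_inv_cancel, map_one, MulAut.one_apply]
    rw [mul_comm g.left, mul_assoc, mul_inv_cancel, mul_one]
  · simp only [SemidirectProduct.mul_right, SemidirectProduct.inv_right, SemidirectProduct.right_inl,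
      mul_one, mul_inv_cancel]

/-- `s^⊓-gp_N(y) = inr(y)` (through `H₉ ⥲ Aut ⋆`). [cite: MochizukiEtTh2009, §5 p.331 (PDF p.105)] -/
theorem homOf_sgpCap_toy₉ (y : Aut (SingleObj.star H₉)) :
    homOf G₉ _ (toy₉.sgpCap y) = SemidirectProduct.inr ((autEquiv H₉).symm y) := rfl

/-- `s^⊓-gp_N(ρ x) = inr(ρ₀ x)` ("the composite of the natural outer homomorphism `Π^tp_X ↠ Aut_D(B_N^bs)` with
`s^⊓-gp_N`", Lemma 5.9 (iii)). [cite: MochizukiEtTh2009, Lem 5.9 (iii) p.332 (PDF p.106)] -/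
theorem homOf_sgpCap_rho_toy₉ (x : Pi) :
    homOf G₉ _ (toy₉.sgpCap (toy₉.ρ x)) = SemidirectProduct.inr (rho₉ x) := by
  change homOf G₉ _ (autEquiv G₉ (SemidirectProduct.inr ((autEquiv H₉).symm (autEquiv H₉ (rho₉ x))))) = _
  rw [MulEquiv.symm_apply_apply, homOf_autEquiv]

/-- Conjugation of a unit by `s^⊓-gp_N(y)` is the Kummer action of `y`: "`Π^tp_Y` [i.e. `G_K` …] acts"
(proof of Lemma 5.8). [cite: MochizukiEtTh2009, Lem 5.8 proof p.331 (PDF p.105)] -/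
theorem homOf_conj_sgpCap_toy₉ (y : Aut (SingleObj.star H₉)) (u : toy₉.units toy₉.BN) :
    homOf G₉ _ (toy₉.sgpCap y * (u : Aut toy₉.BN) * (toy₉.sgpCap y)⁻¹) =
      SemidirectProduct.inl (kumAction ((autEquiv H₉).symm y) (ub₉ u)) := by
  rw [map_mul, map_mul, map_inv, homOf_sgpCap_toy₉, homOf_unit_toy₉, conj_inl_G₉, SemidirectProduct.right_inr]

/-- The commutator `[s^⊓-gp_N(y), u] = (c(y) − 1)·u` in `ℤ/9`. [cite: MochizukiEtTh2009, Lem 5.8 proof p.331 (PDF p.105)] -/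
theorem homOf_comm_sgpCap_toy₉ (y : Aut (SingleObj.star H₉)) (u : toy₉.units toy₉.BN) :
    homOf G₉ _ (toy₉.sgpCap y * (u : Aut toy₉.BN) * (toy₉.sgpCap y)⁻¹ * (u : Aut toy₉.BN)⁻¹) =
      SemidirectProduct.inl (Multiplicative.ofAdd
        ((kumChar ((autEquiv H₉).symm y) - 1) * Multiplicative.toAdd (ub₉ u))) := by
  rw [map_mul, homOf_conj_sgpCap_toy₉, map_inv, homOf_unit_toy₉, ← map_inv, ← map_mul, kumAction_apply]
  congr 1
  change Multiplicative.ofAdd (kumChar _ * Multiplicative.toAdd (ub₉ u) +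
    -Multiplicative.toAdd (ub₉ u)) = _
  congr 1; ring

/-- `(O_K^×)^{1/N}` of toy no. 9: the units whose cube is trivial (`= μ_3(B_N)`; the constants `ℚˣ` meet the
units trivially). [cite: MochizukiEtTh2009, Lem 5.8 p.331 (PDF p.105)] -/
theorem mem_OKxRootN_toy₉_iff (u : Aut toy₉.BN) :
    u ∈ toy₉.OKxRootN ↔ ∃ hu : u ∈ toy₉.units toy₉.BN, ub₉ ⟨u, hu⟩ ^ (3 : ℕ) = 1 := by
  constructor
  · rintro ⟨v, hv, rfl⟩
    refine ⟨v.2, ?_⟩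
    have hv' : toy₉.unitsToBirat toy₉.BN v ∈ toy₉.KxRootN := hv
    obtain ⟨q, hq⟩ := toy₉.mem_KxRootN.mp hv'
    have h1 : ((MonoidHom.inr (Multiplicative (ZMod 9)) ℚˣ q : B₉)).1 =
        ((toy₉.unitsToBirat toy₉.BN v : B₉) ^ (3 : ℕ)).1 := congrArg Prod.fst hq
    have h2 : ub₉ v ^ (3 : ℕ) = 1 := (Prod.pow_fst (toy₉.unitsToBirat toy₉.BN v : B₉) 3).symm.trans h1.symm
    exact h2
  · rintro ⟨hu, h3⟩
    refine Subgroup.mem_map.mpr ⟨⟨u, hu⟩, ?_, rfl⟩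
    change toy₉.unitsToBirat toy₉.BN ⟨u, hu⟩ ∈ toy₉.KxRootN
    rw [ThetaFrobenioid.mem_KxRootN]
    refine ⟨1, ?_⟩
    rw [map_one]
    symm
    change (toy₉.unitsToBirat toy₉.BN ⟨u, hu⟩ : B₉) ^ (3 : ℕ) = 1
    exact Prod.ext ((Prod.pow_fst _ _).trans h3) ((Prod.pow_snd _ _).trans (one_pow _))

/-- `(O_K^×)^{1/N} = μ_3(B_N)` in toy no. 9. [cite: MochizukiEtTh2009, Lem 5.8 p.331 (PDF p.105)] -/
theorem mem_muTorsion_of_mem_OKxRootN_toy₉ {u : Aut toy₉.BN} (hu : u ∈ toy₉.OKxRootN) :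
    u ∈ toy₉.muTorsion toy₉.BN toy₉.N := by
  obtain ⟨hu, h3⟩ := (mem_OKxRootN_toy₉_iff u).mp hu
  exact (unit_mem_muTorsion_iff ⟨u, hu⟩).mpr h3

/-- `Π^tp_Y̲` of toy no. 9 is `Ker` of the first coordinate. [cite: MochizukiEtTh2009, Lem 5.9 (iii) p.332 (PDF p.106)] -/
theorem toy₉_PiY : toy₉.PiY = zq.ker := rfl

/-- `(β)^bs = π₉(β)` for an automorphism `β` of `B_N`. [cite: MochizukiEtTh2009, §5 p.331 (PDF p.105)] -/
theorem autBase_hom_toy₉ (a : Aut toy₉.BN) : (toy₉.autBase toy₉.BN a).hom = π₉ (homOf G₉ _ a) := rfl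

/-- `(s^⊓-gp_N(g))^bs = g`. [cite: MochizukiEtTh2009, §5 p.331 (PDF p.105)] -/
theorem sgpCapSection_toy₉ : toy₉.SgpCapSection := by
  intro b
  apply Aut.ext
  rw [autBase_hom_toy₉]
  change π₉ (SemidirectProduct.inr ((autEquiv H₉).symm b)) = b.hom
  rw [SemidirectProduct.rightHom_inr, autEquiv_symm_apply]
  rfl

/-- `(s^⊓_N)^bs = id`. [cite: MochizukiEtTh2009, §5 p.331 (PDF p.105)] -/
theorem baseIsoAB_toy₉ : toy₉.baseIsoAB = Iso.refl _ := Iso.ext (toy₉.base.map_id _)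

/-- `Aut_D(A_N^bs) ⥲ Aut_D(B_N^bs)` of toy no. 9 is the identity. [cite: MochizukiEtTh2009, §5 p.331 (PDF p.105)] -/
theorem autBaseIsoAB_symm_apply_toy₉ (g : Aut (toy₉.base.obj toy₉.BN)) : toy₉.autBaseIsoAB.symm g = g := by
  rw [MulEquiv.symm_apply_eq]
  change g = toy₉.baseIsoAB.conjAut g
  rw [baseIsoAB_toy₉]
  exact (Aut.ext (by simp [Iso.conjAut_hom, Iso.refl_conj])).symm

/-- Elements of `H_{B_N} = ρ(Π^tp_Ÿ̲)` have trivial `ℤˣ`-component (`Π^tp_Ÿ̲ ⊆ s3⁻¹(𝔄₃)`).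
[cite: MochizukiEtTh2009, §5 p.331 (PDF p.105)] -/
theorem snd_eq_one_of_HB (h : toy₉.HB) : ((autEquiv H₉).symm (h : Aut (toy₉.base.obj toy₉.BN))).2 = 1 := by
  obtain ⟨x, hx, hxh⟩ := h.2
  rw [← hxh]
  change ((autEquiv H₉).symm (autEquiv H₉ (rho₉ x))).2 = 1
  rw [MulEquiv.symm_apply_apply]
  exact sign_s3_piYdd ⟨x, hx⟩

/-- `s^⊔-gp_N(h) = w · inr(h) · w⁻¹`. [cite: MochizukiEtTh2009, §5 p.331 (PDF p.105)] -/
theorem homOf_sgpCup_toy₉ (h : toy₉.HB) :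
    homOf G₉ _ (toy₉.sgpCup h) =
      wElt * SemidirectProduct.inr ((autEquiv H₉).symm (h : Aut (toy₉.base.obj toy₉.BN))) * wElt⁻¹ := by
  change homOf G₉ _ (autEquiv G₉ wElt * sgp₉ h.1 * (autEquiv G₉ wElt)⁻¹) = _
  rw [map_mul, map_mul, map_inv, homOf_autEquiv]
  rfl

/-- **The bi-Kummer difference of toy no. 9 is the Kummer cocycle of `w`**: `s^⊔-gp_N(h)·s^⊓-gp_N(h)⁻¹ = w·(h·w)⁻¹
= 1 − c(h) ∈ ℤ/9`.  [cite: MochizukiEtTh2009, Prop 4.3 (iii) p.317 (PDF p.91)] -/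
theorem homOf_diff_toy₉ (h : toy₉.HB) :
    homOf G₉ _ (toy₉.sgpCup h * (toy₉.sgpCap (h : Aut (toy₉.base.obj toy₉.BN)))⁻¹) =
      SemidirectProduct.inl (Multiplicative.ofAdd
        (1 - kumChar ((autEquiv H₉).symm (h : Aut (toy₉.base.obj toy₉.BN))))) := by
  rw [map_mul, map_inv, homOf_sgpCup_toy₉, homOf_sgpCap_toy₉, wElt, ← map_inv SemidirectProduct.inl,
    mul_assoc, mul_assoc, ← mul_assoc (SemidirectProduct.inr _), conj_inl_G₉, SemidirectProduct.right_inr,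
    ← map_mul, kumAction_apply]
  congr 1
  change Multiplicative.ofAdd ((1 : ZMod 9) + kumChar _ * -1) = _
  congr 1; ring

/-- `3 · (1 − 4^k) = 0` in `ℤ/9`: the Kummer cocycle of `w` on `H_{B_N}` is `μ_3`-valued (Prop. 4.3 (iii), for the toy).
[cite: MochizukiEtTh2009, Prop 4.3 (iii) p.317 (PDF p.91)] -/
theorem three_mul_one_sub_kumChar (k : Multiplicative (ZMod 3)) : (3 : ZMod 9) * (1 - kumChar (k, 1)) = 0 := by
  revert k; decide

/-- **Prop. 4.3 (iii) at toy no. 9**: the bi-Kummer difference is `μ_3(B_N)`-valued.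
[cite: MochizukiEtTh2009, Prop 4.3 (iii) p.317 (PDF p.91)] -/
theorem biKummerDifferenceMem_toy₉ : toy₉.BiKummerDifferenceMem := by
  intro h
  have he : toy₉.sgpCup h * (toy₉.sgpCap (h : Aut (toy₉.base.obj toy₉.BN)))⁻¹ =
      autEquiv G₉ (SemidirectProduct.inl (Multiplicative.ofAdd
        (1 - kumChar ((autEquiv H₉).symm (h : Aut (toy₉.base.obj toy₉.BN)))))) := by
    apply homOf_injective G₉; rw [homOf_diff_toy₉, homOf_autEquiv]
  rw [he, autEquiv_inl_mem_muTorsion_iff, ofAdd_pow_three_eq_one_iff]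
  have h2 : (autEquiv H₉).symm (h : Aut (toy₉.base.obj toy₉.BN)) =
      (((autEquiv H₉).symm (h : Aut (toy₉.base.obj toy₉.BN))).1, 1) := Prod.ext rfl (snd_eq_one_of_HB h)
  rw [h2]
  exact three_mul_one_sub_kumChar _

/-- The defining relation of `s^⊔-gp_N` ("`s^⊔-gp_N(h) ∘ s^⊔_N = s^⊔_N ∘ s^trv_N(h)`") HOLDS in toy no. 9 —
it is what forces `s^⊔-gp_N = w·s^⊓-gp_N·w⁻¹`. [cite: MochizukiEtTh2009, §5 p.331 (PDF p.105)] -/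
theorem sgpCupSpec_toy₉ : toy₉.SgpCupSpec := by
  intro h
  rw [autBaseIsoAB_symm_apply_toy₉]
  change homOf G₉ _ (toy₉.sgpCup h) * wElt = wElt * homOf G₉ _ (sgp₉ h.1)
  rw [homOf_sgpCup_toy₉, inv_mul_cancel_right]
  rfl

/-- The element `x₋ := (0, 0, (0 1))` lies in `Π^tp_Y̲`. [cite: MochizukiEtTh2009, Lem 5.9 (iii) p.332 (PDF p.106)] -/
theorem xNeg_mem : ((1, (1, Equiv.swap 0 1)) : Pi) ∈ zq.ker := MonoidHom.mem_ker.mpr rfl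

/-- `kumChar(ρ₀ x₋) = −1`: `x₋` acts on the units by inversion. [cite: MochizukiEtTh2009, Lem 5.8 proof p.331 (PDF p.105)] -/
theorem kumChar_rho_xNeg : kumChar (rho₉ ((1, (1, Equiv.swap 0 1)) : Pi)) = -1 := by
  have hs : Equiv.Perm.sign (Equiv.swap (0 : Fin 3) 1) = -1 := Equiv.Perm.sign_swap (by decide)
  change (4 : ZMod 9) ^ ((((Multiplicative.toAdd (1 : Multiplicative ℤ)) : ℤ) : ZMod 3)).val *
    (((Equiv.Perm.sign (Equiv.swap (0 : Fin 3) 1) : ℤˣ) : ℤ) : ZMod 9) = -1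
  rw [hs]
  decide

/-- **Lemma 5.8, arithmetic step, at toy no. 9**: a unit is acted on by `Π^tp_Y̲` via `μ_3(B_N)` iff its cube is a
constant (iff it lies in `3ℤ/9`: `x₋` acts by `−1`, and `−2u ∈ 3ℤ/9 ⟺ 3u = 0`).
[cite: MochizukiEtTh2009, Lem 5.8 proof p.331 (PDF p.105)] -/
theorem constantsActByCyclotome_toy₉ : toy₉.ConstantsActByCyclotome := by
  intro u
  rw [mem_OKxRootN_toy₉_iff]
  constructor
  · rintro ⟨hu, h3⟩
    refine ⟨hu, fun y _ => ?_⟩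
    have he : toy₉.sgpCap y * u * (toy₉.sgpCap y)⁻¹ * u⁻¹ = autEquiv G₉ (SemidirectProduct.inl
        (Multiplicative.ofAdd ((kumChar ((autEquiv H₉).symm y) - 1) *
          Multiplicative.toAdd (ub₉ ⟨u, hu⟩)))) := by
      apply homOf_injective G₉; rw [homOf_autEquiv]; exact homOf_comm_sgpCap_toy₉ y ⟨u, hu⟩
    rw [he, autEquiv_inl_mem_muTorsion_iff, ofAdd_pow_three_eq_one_iff, mul_left_comm,
      (pow_three_eq_one_iff _).mp h3, mul_zero]
  · rintro ⟨hu, hact⟩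
    refine ⟨hu, ?_⟩
    have hx : ((1, (1, Equiv.swap 0 1)) : Pi) ∈ toy₉.PiY := by rw [toy₉_PiY]; exact xNeg_mem
    have hmem := hact (rhoAut₉ ((1, (1, Equiv.swap 0 1)) : Pi)) ⟨((1, (1, Equiv.swap 0 1)) : Pi), hx, rfl⟩
    have he : toy₉.sgpCap (rhoAut₉ ((1, (1, Equiv.swap 0 1)) : Pi)) * u * (toy₉.sgpCap (rhoAut₉ ((1, (1, Equiv.swap 0 1)) : Pi)))⁻¹ * u⁻¹ =
        autEquiv G₉ (SemidirectProduct.inl (Multiplicative.ofAdd ((kumChar (rho₉ ((1, (1, Equiv.swap 0 1)) : Pi)) - 1) *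
          Multiplicative.toAdd (ub₉ ⟨u, hu⟩)))) := by
      apply homOf_injective G₉
      rw [homOf_autEquiv]
      have := homOf_comm_sgpCap_toy₉ (rhoAut₉ ((1, (1, Equiv.swap 0 1)) : Pi)) ⟨u, hu⟩
      rwa [show (autEquiv H₉).symm (rhoAut₉ ((1, (1, Equiv.swap 0 1)) : Pi)) = rho₉ ((1, (1, Equiv.swap 0 1)) : Pi) from MulEquiv.symm_apply_apply _ _] at this
    rw [he, autEquiv_inl_mem_muTorsion_iff, ofAdd_pow_three_eq_one_iff, kumChar_rho_xNeg] at hmem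
    rw [pow_three_eq_one_iff]
    have key : ∀ t : ZMod 9, 3 * ((-1 - 1) * t) = 0 → 3 * t = 0 := by decide
    exact key _ hmem

/-- **abc-iut-L2-t4's bundle `Facts` HOLDS at toy no. 9** — a closed §5 datum with `s^⊔_N ≠ s^⊓_N`, `s^⊔-gp_N ≠ s^⊓-gp_N`
and a NON-TRIVIAL bi-Kummer difference cocycle. [cite: MochizukiEtTh2009, §5 pp.330–331 (PDF pp.104–105)] -/
theorem facts_toy₉ : toy₉.Facts where
  sgpCapSpec g := by
    rw [autBaseIsoAB_symm_apply_toy₉]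
    change 𝟙 _ ≫ (toy₉.sgpCap g).hom = (toy₉.sgpCap g).hom ≫ 𝟙 _
    rw [Category.id_comp, Category.comp_id]
  sgpCupSpec := sgpCupSpec_toy₉
  strvSection := sgpCapSection_toy₉
  biKummerDifferenceMem := biKummerDifferenceMem_toy₉
  autAmpleBN g := ⟨toy₉.sgpCap g, sgpCapSection_toy₉ g⟩
  constantsActByCyclotome := constantsActByCyclotome_toy₉
  epi_sCap := by change Epi (𝟙 _); infer_instance
  epi_sCup := by
    change Epi (X := SingleObj.star G₉) (Y := SingleObj.star G₉) wElt
    infer_instance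

/-! ### The dictionary rows at toy no. 9 -/

/-- The Kummer action on `μ_3(B_N) = 3ℤ/9` IS the inversion character of the `ℤˣ`-part (`4 ≡ 1 mod 3`): "acts via multiplication
by" the cyclotomic character (proof of Lemma 5.8), for the toy.  [cite: MochizukiEtTh2009, Lem 5.8 proof p.331 (PDF p.105)] -/
theorem kumAction_triple (h : H₉) (k : Multiplicative (ZMod 3)) :
    kumAction h (triple k) = triple (invAction (Multiplicative (ZMod 3)) h.2 k) := by
  revert h k; decide

/-- **F-1306 `CyclotomicCharacterCompatX` at toy no. 9** (`ι = id`, `m = muEquiv₉`): conjugation by `s^⊓-gp_N(ρ g)` on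
`μ_3(B_N)` is `χ(aug g)` for ALL `g ∈ Π^tp_X̲`. [cite: MochizukiEtTh2009, Lem 5.8 proof p.331 (PDF p.105)] -/
theorem cyclotomicCharacterCompatX_toy₉ : toy₉.CyclotomicCharacterCompatX env₉ (MulEquiv.refl _) muEquiv₉ := by
  intro g u u' hu'
  obtain ⟨k, rfl⟩ := muHom₉_bijective.2 u
  have hk' : u' = muHom₉ (invAction (Multiplicative (ZMod 3)) (Equiv.Perm.sign (s3 g)) k) := by
    apply Subtype.ext; apply homOf_injective G₉
    rw [hu']
    change homOf G₉ _ (toy₉.sgpCap (toy₉.ρ g) * autEquiv G₉ (SemidirectProduct.inl (triple k)) *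
      (toy₉.sgpCap (toy₉.ρ g))⁻¹) = homOf G₉ _ (autEquiv G₉ (SemidirectProduct.inl (triple _)))
    rw [map_mul, map_mul, map_inv, homOf_sgpCap_rho_toy₉, homOf_autEquiv, homOf_autEquiv, ← map_inv,
      ← SemidirectProduct.inl_aut, kumAction_triple]
    rfl
  rw [hk', muEquiv₉_muHom₉, muEquiv₉_muHom₉]
  rfl

/-- `1 − 4^k = 3·(−k)` in `ℤ/9`: the Kummer cocycle of `w` on `Π^tp_Ÿ̲`, read in `μ₃`, is `−(b mod 3)` (Prop. 5.2 (iii), for the toy).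
[cite: MochizukiEtTh2009, Prop 5.2 (iii) p.324 (PDF p.98)] -/
theorem ofAdd_one_sub_kumChar (k : Multiplicative (ZMod 3)) :
    Multiplicative.ofAdd (1 - kumChar (k, 1)) = triple k⁻¹ := by
  revert k; decide

/-- **F-0521 `ThetaSectionCompat` at toy no. 9 for the NON-TRIVIAL theta cocycle `η₉`**: through `m`, the bi-Kummer
difference cocycle `h ↦ s^⊔-gp_N(ρ h)·s^⊓-gp_N(ρ h)⁻¹` IS `η₉⁻¹` ("the Kummer class determined by the bi-Kummer `N`-th root …
corresponds precisely to the reduction modulo `N` of the class `η̲̈^Θ`", Prop. 5.2 (iii), at the toy).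
[cite: MochizukiEtTh2009, Prop 5.2 (iii) p.324 (PDF p.98)] -/
theorem thetaSectionCompat_toy₉ (H : toy₉.Facts) :
    toy₉.ThetaSectionCompat H env₉ (MulEquiv.refl _) muEquiv₉ (fun _ => Iff.rfl) ⇑eta₉Hom := by
  intro h
  have hd : toy₉.diffCocycle H h = muHom₉ (eta₉Hom h)⁻¹ := by
    apply Subtype.ext; apply homOf_injective G₉
    change homOf G₉ _ (toy₉.sgpCup (toy₉.rhoYdd h) *
      (toy₉.sgpCap (toy₉.rhoYdd h : Aut (toy₉.base.obj toy₉.BN)))⁻¹) =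
      homOf G₉ _ (autEquiv G₉ (SemidirectProduct.inl (triple _)))
    rw [homOf_diff_toy₉, homOf_autEquiv]
    have h1 : (autEquiv H₉).symm (toy₉.rhoYdd h : Aut (toy₉.base.obj toy₉.BN)) = (eta₉Hom h, 1) := by
      change (autEquiv H₉).symm (autEquiv H₉ (rho₉ h.1)) = _
      rw [MulEquiv.symm_apply_apply]
      exact Prod.ext rfl (sign_s3_piYdd h)
    rw [h1, ofAdd_one_sub_kumChar, map_inv]
  rw [hd, muEquiv₉_muHom₉]
  rfl

end Toy

end ThetaFrobenioid

end Literature.AnabelianGeometry.EtaleTheta
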